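import Literature.NumberTheory.Automorphic.QuaternionUnitsTraceNormalized
import Literature.NumberTheory.Automorphic.HilbertRepHilbertSchmidtBlocks
import HarnessLib

/-!
# The trace formula for `D^×`: spectral side `Σ_{W} ‖R(f)|_W‖²_{HS}` against the geometric side with
# the printed volumes (Gelbart, *Automorphic forms on adele groups* (1975), (10.14))

Topic `NumberTheory/Automorphic`; one theorem (no definition, no named fact, no instance), joining
the two halves of Gelbart's trace formula (10.14) for the multiplicative group of a division
quaternion algebra `D` over a number field `K`, in the Hilbert–Schmidt form that avoids trace-class
theory (`Φ' = f ⋆ f^*`, `tr π'(f ⋆ f^*) = ‖π'(f)‖²_{HS}`):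

* spectral side — `HilbertRepHilbertSchmidtBlocks` (sibling unit): for an orthogonal decomposition
  `S` of `L²(D_𝔸ˣ ⧸ ℝ_{>0} Dˣ)` into closed invariant subspaces, `Σ_l ‖R(f) e_l‖ₑ² =
  Σ_{W ∈ S} Σ_k ‖R(f) e^W_k‖ₑ²` (`ClosedSubrep.tsum_enorm_sq_apply_eq_tsum_set`), the blocks being the
  Hilbert–Schmidt norms `‖R(f)|_W‖²_{HS}`, equal along unitary equivalence classes and adding up to
  `Σ_σ m(σ) ‖σ(f)‖²_{HS}` (`IsUnitary.tsum_fiber_tsum_enorm_sq_eq`); such decompositions into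
  irreducibles exist (`AdelicGroupData.exists_orthogonalDecomposition_rightRegular_units`);
* geometric side — `QuaternionUnitsTraceNormalized`: `Σ_l ‖R(f) e_l‖ₑ² = ofReal (V(f))` with
  `V(f) = Σ'_c vol(G_c ⧸ H_c) ∫_{G ⧸ G_c} (f ⋆ f^*)_A(y γ_c y⁻¹) d(ν/ν_c)` real, the volumes and quotient
  measures being the printed ones (Remark 9.23).

`units_tsum_tsum_enorm_sq_integratedOperator_eq_ofReal_geometric` states the resulting identity
`Σ_{W ∈ S} ‖R(f)|_W‖²_{HS} = V(f)` in `[0, ∞]`. What is NOT here: the comparison with `GL(2)`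
((10.15)–(10.22)), which together with this identity yields Thm. 10.5 / 10.10 (and
`strong_multiplicity_one_quaternionUnits`, of whose inline D-0026 decomposition this is a brick).

## References

* S. Gelbart, *Automorphic forms on adele groups*, Ann. of Math. Studies 83 (1975), (10.12)–(10.14),
  Remark 9.23 [Gelbart1975].
-/

noncomputable section

open NumberField IsDedekindDomain MeasureTheory Measure Topology
open Literature.MeasureTheory.Group
open scoped NNReal ENNReal TensorProduct Pointwise

namespace Literature.NumberTheory.Automorphic

-- the coset spaces carry Borel σ-algebras supplied locally, not the quotient σ-algebra
attribute [-instance] Quotient.instMeasurableSpace QuotientGroup.measurableSpace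

universe u

section TraceFormula

variable (K : Type) [Field K] [NumberField K] (D : Type u) [Ring D] [Algebra K D]
  [IsQuaternionAlgebra K D]
  [MeasurableSpace (AdelicGroupData.units K D).Adelic] [BorelSpace (AdelicGroupData.units K D).Adelic]
  [∀ γ : (AdelicGroupData.units K D).Adelic, MeasurableSpace ((AdelicGroupData.units K D).Adelic ⧸
    Subgroup.centralizer ({γ} : Set (AdelicGroupData.units K D).Adelic))]
  [∀ γ : (AdelicGroupData.units K D).Adelic, BorelSpace ((AdelicGroupData.units K D).Adelic ⧸
    Subgroup.centralizer ({γ} : Set (AdelicGroupData.units K D).Adelic))]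
  [∀ γ : (AdelicGroupData.units K D).Adelic, MeasurableSpace
    (↥(Subgroup.centralizer ({γ} : Set (AdelicGroupData.units K D).Adelic)) ⧸
      ((AdelicGroupData.units K D).quotientSubgroup ⊓
        Subgroup.centralizer ({γ} : Set (AdelicGroupData.units K D).Adelic)).subgroupOf
        (Subgroup.centralizer ({γ} : Set (AdelicGroupData.units K D).Adelic)))]
  [∀ γ : (AdelicGroupData.units K D).Adelic, BorelSpace
    (↥(Subgroup.centralizer ({γ} : Set (AdelicGroupData.units K D).Adelic)) ⧸
      ((AdelicGroupData.units K D).quotientSubgroup ⊓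
        Subgroup.centralizer ({γ} : Set (AdelicGroupData.units K D).Adelic)).subgroupOf
        (Subgroup.centralizer ({γ} : Set (AdelicGroupData.units K D).Adelic)))]

attribute [local instance] AdelicGroupData.measurableSpaceQuotientForm
  AdelicGroupData.borelSpaceQuotientForm AdelicGroupData.smulInvariantMeasureQuotientForm
  AdelicGroupData.isFiniteMeasureOnCompactsQuotientForm AdelicGroupData.isFiniteMeasureQuotientForm

local notation "GD" => AdelicGroupData.units K D

/-- **The trace formula for `D^×`, spectral side against geometric side** (Gelbart (1975),
(10.14): `tr R'(Φ') = Σ_{π'} m(π') tr π'(Φ')` on the one hand — here for `Φ' = f ⋆ f^*`, where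
`tr π'(f ⋆ f^*) = ‖π'(f)‖²_{HS}` — and `= Σ_{{γ}} meas(Z G(γ)_F \ G(γ)_𝔸) ∫ Φ'(x⁻¹ γ x)` on the
other). Let `D` be a division quaternion algebra over `K`, `μ` automorphic, `α`, `ν`, `ν_c`,
`ρ_{H,c}`, `ρ_{F,c}` as in `units_hasSum_norm_sq_integratedOperator_eq_tsum_covol_mul`, and let
`S` be an orthogonal decomposition of `L²(D_𝔸ˣ ⧸ ℝ_{>0} Dˣ, μ)` into closed invariant subspaces
with closed span everything (e.g. into irreducibles,
`exists_orthogonalDecomposition_rightRegular_units`), with Hilbert bases `(e^W_k)_k` of the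
members. Then, `L²` having a countable Hilbert basis `(e_l)`,

  `Σ'_{W ∈ S} Σ'_k ‖R(f) e^W_k‖ₑ² = ofReal ( Σ'_c vol(G_c ⧸ H_c) ∫_{G ⧸ G_c} (f ⋆ f^*)_A(y γ_c y⁻¹) d(ν/ν_c) )`

in `[0, ∞]`: the left-hand side is the sum of the Hilbert–Schmidt norms `‖R(f)|_W‖²_{HS}` of the
blocks (`ClosedSubrep.tsum_enorm_sq_apply_eq_tsum_set`, which regroups to
`Σ_σ m(σ) ‖σ(f)‖²_{HS}` by `IsUnitary.tsum_fiber_tsum_enorm_sq_eq`), the right-hand side the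
geometric side with the printed volumes (`units_tsum_enorm_sq_integratedOperator_eq_ofReal`, real
and non-negative). [cite: Gelbart1975, (10.14)] -/
theorem units_tsum_tsum_enorm_sq_integratedOperator_eq_ofReal_geometric
    (hdiv : ∀ x : D, x ≠ 0 → IsUnit x)
    [LocallyCompactSpace (GD).Adelic] [SecondCountableTopology (GD).Adelic] [T2Space (GD).Adelic]
    [hH : IsClosed ((GD).quotientSubgroup : Set (GD).Adelic)]
    [hCcl : ∀ γ : (GD).Adelic, IsClosed ((Subgroup.centralizer ({γ} : Set (GD).Adelic) :
      Subgroup (GD).Adelic) : Set (GD).Adelic)]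
    (μ : Measure (GD).automorphicQuotient) [(GD).IsAutomorphicMeasure μ]
    (α : Measure (GD).center') [α.IsHaarMeasure] [SFinite α]
    (ν : Measure (GD).Adelic) [IsHaarMeasure ν] [ν.IsMulRightInvariant] [ν.IsInvInvariant]
    (ρH : ∀ c : ConjClasses (GD).arithmeticSubgroup, Measure ↥((GD).quotientSubgroup ⊓
      Subgroup.centralizer ({((Quotient.out c : (GD).arithmeticSubgroup) : (GD).Adelic)} :
        Set (GD).Adelic)))
    [∀ c, IsHaarMeasure (ρH c)] [∀ c, (ρH c).IsInvInvariant] [∀ c, SFinite (ρH c)]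
    (ρF : ∀ c : ConjClasses (GD).arithmeticSubgroup, Measure ↥(((GD).quotientSubgroup ⊓
      Subgroup.centralizer ({((Quotient.out c : (GD).arithmeticSubgroup) : (GD).Adelic)} :
        Set (GD).Adelic)).subgroupOf (Subgroup.centralizer
          ({((Quotient.out c : (GD).arithmeticSubgroup) : (GD).Adelic)} : Set (GD).Adelic))))
    [∀ c, IsHaarMeasure (ρF c)] [∀ c, (ρF c).IsInvInvariant] [∀ c, SFinite (ρF c)]
    (νC : ∀ c : ConjClasses (GD).arithmeticSubgroup, Measure ↥(Subgroup.centralizer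
      ({((Quotient.out c : (GD).arithmeticSubgroup) : (GD).Adelic)} : Set (GD).Adelic)))
    [∀ c, IsHaarMeasure (νC c)] [∀ c, (νC c).IsMulRightInvariant] [∀ c, (νC c).IsInvInvariant]
    [∀ c, SFinite (νC c)]
    (hρH : ∀ c, ρH c = (Measure.map (fun p : (GD).center' × (GD).arithmeticSubgroup =>
      (⟨(p.1 : (GD).Adelic) * p.2, AdelicGroupData.mulMap_mem (GD) p⟩ : (GD).quotientSubgroup))
        (α.prod count)).comap (Subgroup.inclusion inf_le_left))
    (hρF : ∀ c, ρF c = Measure.map (Subgroup.subgroupOfEquivOfLe inf_le_right).symm (ρH c))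
    (f : CompactlySupportedContinuousMap (GD).Adelic ℂ) {ι : Type*} [Countable ι]
    (b : HilbertBasis ι ℂ ((GD).L2 μ))
    {S : Set (ContRepresentation.ClosedSubrep ((GD).rightRegular μ))}
    (horth : S.Pairwise fun W W' => W.toSubmodule ⟂ W'.toSubmodule)
    (hdense : ContRepresentation.ClosedSubrep.iSupClosure S = ⊤)
    {κ : S → Type*} (bW : ∀ W : S, HilbertBasis (κ W) ℂ
      (W : ContRepresentation.ClosedSubrep ((GD).rightRegular μ)).toSubmodule) :
    ∑' W : S, ∑' k, ‖((GD).rightRegular μ).integratedOperator ((GD).isUnitary_rightRegular μ)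
        ((GD).isStronglyContinuous_rightRegular_holds μ) ν f (bW W k)‖ₑ ^ 2 =
      ENNReal.ofReal (∑' c : ConjClasses (GD).arithmeticSubgroup,
        (((quotientMeasure (((GD).quotientSubgroup ⊓ Subgroup.centralizer
            ({((Quotient.out c : (GD).arithmeticSubgroup) : (GD).Adelic)} : Set (GD).Adelic)).subgroupOf
            (Subgroup.centralizer ({((Quotient.out c : (GD).arithmeticSubgroup) : (GD).Adelic)} :
              Set (GD).Adelic))) (ρF c) (isClosed_subgroupOf _ _ (hH.inter (hCcl _))) (νC c)
            Set.univ).toReal : ℝ) : ℂ) *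
          ∫ y, descConj ((Quotient.out c : (GD).arithmeticSubgroup) : (GD).Adelic)
            (Subgroup.centralizer ({((Quotient.out c : (GD).arithmeticSubgroup) : (GD).Adelic)} :
              Set (GD).Adelic)) (mem_centralizer_singleton_comm _)
            (fun g => ∫ a, mulConv ν f (mulStar f) ((a : (GD).Adelic)⁻¹ * g) ∂α) y
            ∂quotientMeasure (Subgroup.centralizer
              ({((Quotient.out c : (GD).arithmeticSubgroup) : (GD).Adelic)} : Set (GD).Adelic))
              (νC c) (hCcl _) ν).re := by
  rw [← ContRepresentation.ClosedSubrep.tsum_enorm_sq_apply_eq_tsum_set horth hdense bW b]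
  exact (units_tsum_enorm_sq_integratedOperator_eq_ofReal K D hdiv μ α ν ρH ρF νC hρH hρF f b).1

end TraceFormula

end Literature.NumberTheory.Automorphic
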